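import Mathlib
import Summits.KontsevichZagierPeriods.Zeta5Search.PhiHatFourthOrder
import Summits.KontsevichZagierPeriods.Zeta5Search.ThirdDigitVTransport
import Summits.KontsevichZagierPeriods.Zeta5Search.RecordCellADigitsA
import HarnessLib

/-!
# ζ(5) search — FOURTH-ORDER TRANSPORT of the class units (tool for (W4)/(V4))

Cell `pub-zeta5` (HONEST FRAMING: systematic search; no irrationality claim unless certified), gen-2 seat generation 15
(REPORT-gen2-g15 §3).  `ThirdDigitVTransport.thirdOrder_transport_bound` (typer g12) one order further: moving the units of a
class point `s = x + ℓp` to the base `x`,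
**`ĝ_s(ρ₃ − pφ_sρ₄ + p²c_sρ₅ − p³c₃,sρ₆) ≡ ĝ_x(ρ₃ − pφ_x(ℓρ₃ + ρ₄) + p²c_x(ℓ²ρ₃ + 2ℓρ₄ + ρ₅) − p³c₃,x(ℓ³ρ₃ + 3ℓ²ρ₄ + 3ℓρ₅ + ρ₆)) (mod p⁴)`**
for `p`-integral `ρ₃, …, ρ₆` (`fourthOrder_transport_bound`; `c₃ = (φ³ − 3φφ₂ + 2φ₃)/6`, `φ₃ = phi3Expl`), from the class-level
transports `ĝ` (mod `p⁴`, `padicNorm_gHat_sub_fourth_le`), `φ` (mod `p³`, `padicNorm_phiHat_sub_third_le`), `c` (mod `p²`,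
`padicNorm_curvHat_sub_second_le` below: `c_s ≡ c_x + ℓp(φ_xφ₂,x − φ₃,x)`), `c₃` (mod `p`) and ONE polynomial identity
(`fourthOrder_transport_identity`, using `φ₂ = φ² − 2c`, `φ₃ = 3c₃ + φ³ − 3φc`).  The brackets `(ℓρ₃ + ρ₄)`, `(ℓ²ρ₃ + 2ℓρ₄ + ρ₅)`,
`(ℓ³ρ₃ + 3ℓ²ρ₄ + 3ℓρ₅ + ρ₆)` are the point-`s` contributions to the functionals `ŵ[ηⁿΦ_x]`, `n = 1, 2, 3` (`wHat2/3/4`).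
Generic `padicNorm` algebra over `ℚ`; nothing here concerns irrationality.
-/

noncomputable section

open Finset

namespace Summit.KontsevichZagierPeriods.Zeta5Search.SecondOrder

open Summit.KontsevichZagierPeriods.Zeta5Search.CasoratianValuation (InPolytope)
open Summit.KontsevichZagierPeriods.Zeta5Search.ClusterValuation
open Summit.KontsevichZagierPeriods.Zeta5Search.PadicSeries
open Summit.KontsevichZagierPeriods.Zeta5Search.CellA (padicNorm_pow_eq padicNorm_p)
open Summit.KontsevichZagierPeriods.Zeta5Search.BigPrime (padicNorm_mul_le_one)

variable {p : ℕ} [hp : Fact p.Prime]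

/-! ### `p`-integrality bookkeeping -/

omit hp in
/-- `‖−x‖ ≤ 1` for `p`-integral `x`. -/
theorem padicNorm_neg_le_one {x : ℚ} (hx : padicNorm p x ≤ 1) : padicNorm p (-x) ≤ 1 := by
  rwa [padicNorm.neg]

/-- `‖xⁿ‖ ≤ 1` for `p`-integral `x`. -/
theorem padicNorm_pow_le_one {x : ℚ} (hx : padicNorm p x ≤ 1) (n : ℕ) : padicNorm p (x ^ n) ≤ 1 := by
  rw [padicNorm_pow_eq]; exact pow_le_one₀ (padicNorm.nonneg _) hx

/-- Numerals are `p`-integral. -/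
theorem padicNorm_ofNat_le_one (n : ℕ) [n.AtLeastTwo] : padicNorm p (ofNat(n) : ℚ) ≤ 1 := by
  have h := padicNorm.of_nat (p := p) (OfNat.ofNat n)
  rwa [Nat.cast_ofNat] at h

omit hp in
/-- `‖1‖ ≤ 1`. -/
theorem padicNorm_one_le_one : padicNorm p (1 : ℚ) ≤ 1 := by simp

/-! ### `c₃` is `p`-integral; `c` to second order -/

/-- **`c₃,x = (φ_x³ − 3φ_xφ₂,x + 2φ₃,x)/6` is `p`-integral** (`p ≥ 5`). -/
theorem padicNorm_cubicExpl_le_one (b : ℕ → ℤ) (hp5 : 5 ≤ p) (x : ℕ) :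
    padicNorm p ((phiHat b p x ^ 3 - 3 * phiHat b p x * phi2Hat b p x + 2 * phi3Expl b p x) / 6) ≤ 1 := by
  have hp2 : p ≠ 2 := by omega
  rw [padicNorm.div, padicNorm_six hp5, div_one]
  have h1 := padicNorm_phiHat_le_one b hp2 x
  have h2 := padicNorm_phi2Hat_le_one b hp2 x
  have h3 := padicNorm_phi3Expl_le_one b hp2 x
  exact CellA.nI_add (CellA.nI_sub (padicNorm_pow_le_one h1 3)
    (padicNorm_mul_le_one (padicNorm_mul_le_one (padicNorm_ofNat_le_one 3) h1) h2))
    (padicNorm_mul_le_one (padicNorm_ofNat_le_one 2) h3)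

/-- **`c_q ≡ c_x + ℓp(φ_xφ₂,x − φ₃,x) (mod p²)`** for `x < p` and `q = x + ℓp` in the class of `x` (`p` odd): the curvature to
second order, from `c = (φ² − φ₂)/2`, `φ_q ≡ φ_x + ℓpφ₂,x (mod p²)` and `φ₂,q ≡ φ₂,x + 2ℓpφ₃,x (mod p²)`. -/
theorem padicNorm_curvHat_sub_second_le (b : ℕ → ℤ) (hp2 : p ≠ 2) {x q : ℕ} (hx : x < p) (hq : q ∈ classSet b p x) :
    padicNorm p (curvHat b p q
      - (curvHat b p x + ((q / p : ℕ) : ℚ) * p * (phiHat b p x * phi2Hat b p x - phi3Expl b p x))) ≤ (p : ℚ) ^ (-(2 : ℤ)) := by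
  have hp0 : (p : ℚ) ≠ 0 := Nat.cast_ne_zero.2 hp.out.ne_zero
  set ℓ : ℚ := ((q / p : ℕ) : ℚ) with hℓ
  set u := phiHat b p q - (phiHat b p x + ℓ * p * phi2Hat b p x) with hu
  set v := phi2Hat b p q - (phi2Hat b p x + 2 * (ℓ * p) * phi3Expl b p x) with hv
  have hU : padicNorm p u ≤ (p : ℚ) ^ (-(2 : ℤ)) := padicNorm_phiHat_sub_second_le b hp2 hx hq
  have hV : padicNorm p v ≤ (p : ℚ) ^ (-(2 : ℤ)) := padicNorm_phi2Hat_sub_second_le b hp2 hx hq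
  have hU1 : padicNorm p u ≤ 1 := hU.trans (zpow_le_one_of_nonpos₀ one_le_p (by norm_num))
  have hℓn : padicNorm p ℓ ≤ 1 := by rw [hℓ]; simpa using padicNorm.of_nat (p := p) (q / p)
  have hφ := padicNorm_phiHat_le_one b hp2 x
  have hφ2 := padicNorm_phi2Hat_le_one b hp2 x
  have e : curvHat b p q - (curvHat b p x + ℓ * p * (phiHat b p x * phi2Hat b p x - phi3Expl b p x))
      = ((p : ℚ) ^ 2 * (ℓ ^ 2 * phi2Hat b p x ^ 2) + (2 * phiHat b p x + 2 * (ℓ * p) * phi2Hat b p x + u) * u - v) / 2 := by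
    rw [curvHat, curvHat, hu, hv]; ring
  rw [e, padicNorm.div, padicNorm_two hp2, div_one]
  refine (padicNorm.sub (p := p)).trans (max_le ((padicNorm.nonarchimedean (p := p)).trans (max_le ?_ ?_)) hV)
  · exact (padicNorm_p_pow_mul_le 2 (padicNorm_mul_le_one (padicNorm_pow_le_one hℓn 2) (padicNorm_pow_le_one hφ2 2))).trans
      (by rw [mul_one]; norm_num)
  · exact padicNorm_mul_le_right (CellA.nI_add (CellA.nI_add (padicNorm_mul_le_one (padicNorm_ofNat_le_one 2) hφ)
      (padicNorm_mul_le_one (padicNorm_mul_le_one (padicNorm_ofNat_le_one 2) (padicNorm_mul_le_one hℓn padicNorm_p_le_one)) hφ2))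
      hU1) hU

/-! ### Transport of the class units to fourth order -/

/-- The fourth-order transport identity behind (W4)/(V4): with `φ₂ = φ² − 2c` and `φ₃ = 3c₃ + φ³ − 3φc`
(i.e. `c₃ = (φ³ − 3φφ₂ + 2φ₃)/6`),
`(1 − ℓPφ + ℓ²P²c − ℓ³P³c₃)(ρ₃ − Pφ'ρ₄ + P²c'ρ₅ − P³c₃'ρ₆) − (ρ₃ − Pφ(ℓρ₃+ρ₄) + P²c(ℓ²ρ₃+2ℓρ₄+ρ₅) − P³c₃(ℓ³ρ₃+3ℓ²ρ₄+3ℓρ₅+ρ₆))`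
`= −P(φ' − φ − ℓPφ₂ − ℓ²P²φ₃)ρ₄(1 − ℓPφ + ℓ²P²c) + P²(c' − c − ℓP(φc − 3c₃))ρ₅(1 − ℓPφ) − P³(c₃' − c₃)ρ₆ + P⁴·D`
with `D` an explicit polynomial. -/
theorem fourthOrder_transport_identity (P ℓ φ φ' φ₂ φ₃ c c' c₃ c₃' ρ3 ρ4 ρ5 ρ6 : ℚ) (hφ₂ : φ₂ = φ ^ 2 - 2 * c)
    (hφ₃ : φ₃ = 3 * c₃ + φ ^ 3 - 3 * φ * c) :
    (1 - ℓ * P * φ + (ℓ * P) ^ 2 * c - (ℓ * P) ^ 3 * c₃) * (ρ3 - P * φ' * ρ4 + P ^ 2 * c' * ρ5 - P ^ 3 * c₃' * ρ6)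
      - (ρ3 - P * φ * (ℓ * ρ3 + ρ4) + P ^ 2 * c * (ℓ ^ 2 * ρ3 + 2 * ℓ * ρ4 + ρ5)
          - P ^ 3 * c₃ * (ℓ ^ 3 * ρ3 + 3 * ℓ ^ 2 * ρ4 + 3 * ℓ * ρ5 + ρ6)) =
    -P * ((φ' - (φ + ℓ * P * φ₂ + (ℓ * P) ^ 2 * φ₃)) * ρ4 * (1 - ℓ * P * φ + (ℓ * P) ^ 2 * c))
      + P ^ 2 * ((c' - (c + ℓ * P * (φ * c - 3 * c₃))) * ρ5 * (1 - ℓ * P * φ))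
      - P ^ 3 * ((c₃' - c₃) * ρ6)
      + P ^ 4 * (ℓ ^ 3 * ρ4 * (φ * φ₃ - c * φ₂ - ℓ * P * c * φ₃ + c₃ * φ')
          + ℓ ^ 2 * ρ5 * (c * c' - φ * (φ * c - 3 * c₃) - ℓ * P * c₃ * c')
          + ℓ * c₃' * ρ6 * (φ - ℓ * P * c + (ℓ * P) ^ 2 * c₃)) := by
  subst hφ₂ hφ₃; ring

/-- **Fourth-order transport, core estimate over opaque atoms.**  If `ĝ' ≡ ĝ(1 − ℓpφ + ℓ²p²c − ℓ³p³c₃) (mod p⁴)`,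
`φ' ≡ φ + ℓpφ₂ + ℓ²p²φ₃ (mod p³)`, `c' ≡ c + ℓp(φc − 3c₃) (mod p²)`, `c₃' ≡ c₃ (mod p)`, all atoms `p`-integral, `φ₂ = φ² − 2c` and
`φ₃ = 3c₃ + φ³ − 3φc`, then
`ĝ'(ρ₃ − pφ'ρ₄ + p²c'ρ₅ − p³c₃'ρ₆) ≡ ĝ(ρ₃ − pφ(ℓρ₃ + ρ₄) + p²c(ℓ²ρ₃ + 2ℓρ₄ + ρ₅) − p³c₃(ℓ³ρ₃ + 3ℓ²ρ₄ + 3ℓρ₅ + ρ₆)) (mod p⁴)`. -/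
theorem fourthOrder_transport_core {ℓ g gs φ φs φ₂ φ₃ c cs c₃ c₃s ρ3 ρ4 ρ5 ρ6 : ℚ} (hℓn : padicNorm p ℓ ≤ 1)
    (hgx1 : padicNorm p g ≤ 1) (hφ1 : padicNorm p φ ≤ 1) (hφs1 : padicNorm p φs ≤ 1) (hφ21 : padicNorm p φ₂ ≤ 1)
    (hφ31 : padicNorm p φ₃ ≤ 1) (hc1 : padicNorm p c ≤ 1) (hcs1 : padicNorm p cs ≤ 1) (hc31 : padicNorm p c₃ ≤ 1)
    (hc3s1 : padicNorm p c₃s ≤ 1) (hρ3n : padicNorm p ρ3 ≤ 1) (hρ4n : padicNorm p ρ4 ≤ 1) (hρ5n : padicNorm p ρ5 ≤ 1)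
    (hρ6n : padicNorm p ρ6 ≤ 1) (hφ2c : φ₂ = φ ^ 2 - 2 * c) (hφ3c : φ₃ = 3 * c₃ + φ ^ 3 - 3 * φ * c)
    (hA : padicNorm p (gs - g * (1 - ℓ * p * φ + (ℓ * p) ^ 2 * c - (ℓ * p) ^ 3 * c₃)) ≤ (p : ℚ) ^ (-(4 : ℤ)))
    (hBφ : padicNorm p (φs - (φ + ℓ * p * φ₂ + (ℓ * p) ^ 2 * φ₃)) ≤ (p : ℚ) ^ (-(3 : ℤ)))
    (hCc : padicNorm p (cs - (c + ℓ * p * (φ * c - 3 * c₃))) ≤ (p : ℚ) ^ (-(2 : ℤ)))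
    (hDc : padicNorm p (c₃s - c₃) ≤ (p : ℚ) ^ (-(1 : ℤ))) :
    padicNorm p (gs * (ρ3 - (p : ℚ) * φs * ρ4 + (p : ℚ) ^ 2 * cs * ρ5 - (p : ℚ) ^ 3 * c₃s * ρ6)
      - g * (ρ3 - (p : ℚ) * φ * (ℓ * ρ3 + ρ4) + (p : ℚ) ^ 2 * c * (ℓ ^ 2 * ρ3 + 2 * ℓ * ρ4 + ρ5)
          - (p : ℚ) ^ 3 * c₃ * (ℓ ^ 3 * ρ3 + 3 * ℓ ^ 2 * ρ4 + 3 * ℓ * ρ5 + ρ6))) ≤ (p : ℚ) ^ (-(4 : ℤ)) := by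
  have hp0 : (p : ℚ) ≠ 0 := Nat.cast_ne_zero.2 hp.out.ne_zero
  have hp1 : padicNorm p (p : ℚ) ≤ 1 := padicNorm_p_le_one
  have hpn : padicNorm p (p : ℚ) = (p : ℚ) ^ (-(1 : ℤ)) := padicNorm_p
  have h1n : padicNorm p (1 : ℚ) ≤ 1 := padicNorm_one_le_one
  have h3n : padicNorm p (3 : ℚ) ≤ 1 := padicNorm_ofNat_le_one 3
  -- the algebra: `ĝ'X' − ĝW = (ĝ' − ĝB)X' + ĝ(BX' − W)` and the transport identity for `BX' − W`
  have hR := fourthOrder_transport_identity (p : ℚ) ℓ φ φs φ₂ φ₃ c cs c₃ c₃s ρ3 ρ4 ρ5 ρ6 hφ2c hφ3c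
  have split : ∀ a a' B X W : ℚ, a' * X - a * W = (a' - a * B) * X + a * (B * X - W) := fun _ _ _ _ _ => by ring
  rw [split g gs (1 - ℓ * p * φ + (ℓ * p) ^ 2 * c - (ℓ * p) ^ 3 * c₃), hR]
  -- `p`-integrality of the polynomial expressions in the atoms (structural, leaf by leaf)
  have hX : padicNorm p (ρ3 - (p : ℚ) * φs * ρ4 + (p : ℚ) ^ 2 * cs * ρ5 - (p : ℚ) ^ 3 * c₃s * ρ6) ≤ 1 :=
    (CellA.nI_sub (CellA.nI_add (CellA.nI_sub hρ3n (padicNorm_mul_le_one (padicNorm_mul_le_one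
      hp1 hφs1) hρ4n)) (padicNorm_mul_le_one (padicNorm_mul_le_one (padicNorm_pow_le_one hp1 2) hcs1) hρ5n))
      (padicNorm_mul_le_one (padicNorm_mul_le_one (padicNorm_pow_le_one hp1 3) hc3s1) hρ6n))
  have hY : padicNorm p (1 - ℓ * p * φ + (ℓ * p) ^ 2 * c) ≤ 1 :=
    (CellA.nI_add (CellA.nI_sub h1n (padicNorm_mul_le_one (padicNorm_mul_le_one hℓn hp1) hφ1))
      (padicNorm_mul_le_one (padicNorm_pow_le_one (padicNorm_mul_le_one hℓn hp1) 2) hc1))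
  have hD : padicNorm p (ℓ ^ 3 * ρ4 * (φ * φ₃ - c * φ₂ - ℓ * p * c * φ₃ + c₃ * φs)
      + ℓ ^ 2 * ρ5 * (c * cs - φ * (φ * c - 3 * c₃) - ℓ * p * c₃ * cs)
      + ℓ * c₃s * ρ6 * (φ - ℓ * p * c + (ℓ * p) ^ 2 * c₃)) ≤ 1 :=
    (CellA.nI_add (CellA.nI_add (padicNorm_mul_le_one (padicNorm_mul_le_one (padicNorm_pow_le_one hℓn
      3) hρ4n) (CellA.nI_add (CellA.nI_sub (CellA.nI_sub (padicNorm_mul_le_one hφ1 hφ31)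
      (padicNorm_mul_le_one hc1 hφ21)) (padicNorm_mul_le_one (padicNorm_mul_le_one (padicNorm_mul_le_one hℓn hp1) hc1)
      hφ31)) (padicNorm_mul_le_one hc31 hφs1))) (padicNorm_mul_le_one (padicNorm_mul_le_one (padicNorm_pow_le_one hℓn
      2) hρ5n) (CellA.nI_sub (CellA.nI_sub (padicNorm_mul_le_one hc1 hcs1) (padicNorm_mul_le_one hφ1
      (CellA.nI_sub (padicNorm_mul_le_one hφ1 hc1) (padicNorm_mul_le_one h3n hc31)))) (padicNorm_mul_le_one
      (padicNorm_mul_le_one (padicNorm_mul_le_one hℓn hp1) hc31) hcs1)))) (padicNorm_mul_le_one (padicNorm_mul_le_one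
      (padicNorm_mul_le_one hℓn hc3s1) hρ6n) (CellA.nI_add (CellA.nI_sub hφ1 (padicNorm_mul_le_one
      (padicNorm_mul_le_one hℓn hp1) hc1)) (padicNorm_mul_le_one (padicNorm_pow_le_one (padicNorm_mul_le_one hℓn hp1)
      2) hc31))))
  -- the five pieces are `O(p⁻⁴)`
  have h0 : padicNorm p ((gs - g * (1 - ℓ * p * φ + (ℓ * p) ^ 2 * c - (ℓ * p) ^ 3 * c₃))
      * (ρ3 - (p : ℚ) * φs * ρ4 + (p : ℚ) ^ 2 * cs * ρ5 - (p : ℚ) ^ 3 * c₃s * ρ6)) ≤ (p : ℚ) ^ (-(4 : ℤ)) :=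
    padicNorm_mul_le_left hA hX
  have h1 : padicNorm p (-(p : ℚ) * ((φs - (φ + ℓ * p * φ₂ + (ℓ * p) ^ 2 * φ₃)) * ρ4 * (1 - ℓ * p * φ + (ℓ * p) ^ 2 * c))) ≤
      (p : ℚ) ^ (-(4 : ℤ)) := by
    rw [padicNorm.mul, padicNorm.neg, hpn]
    calc (p : ℚ) ^ (-(1 : ℤ)) * _ ≤ (p : ℚ) ^ (-(1 : ℤ)) * (p : ℚ) ^ (-(3 : ℤ)) :=
          mul_le_mul_of_nonneg_left (padicNorm_mul_le_left (padicNorm_mul_le_left hBφ hρ4n) hY) (zpow_p_nonneg _)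
      _ = (p : ℚ) ^ (-(4 : ℤ)) := by rw [← zpow_add₀ hp0]; norm_num
  have h2 : padicNorm p ((p : ℚ) ^ 2 * ((cs - (c + ℓ * p * (φ * c - 3 * c₃))) * ρ5 * (1 - ℓ * p * φ))) ≤
      (p : ℚ) ^ (-(4 : ℤ)) := by
    have hY' : padicNorm p (1 - ℓ * p * φ) ≤ 1 :=
      CellA.nI_sub h1n (padicNorm_mul_le_one (padicNorm_mul_le_one hℓn hp1) hφ1)
    exact (padicNorm_p_pow_mul_le 2 (padicNorm_mul_le_left (padicNorm_mul_le_left hCc hρ5n) hY')).trans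
      (by rw [← zpow_add₀ hp0]; norm_num)
  have h3 : padicNorm p ((p : ℚ) ^ 3 * ((c₃s - c₃) * ρ6)) ≤ (p : ℚ) ^ (-(4 : ℤ)) :=
    (padicNorm_p_pow_mul_le 3 (padicNorm_mul_le_left hDc hρ6n)).trans (by rw [← zpow_add₀ hp0]; norm_num)
  have h4 : padicNorm p ((p : ℚ) ^ 4 * (ℓ ^ 3 * ρ4 * (φ * φ₃ - c * φ₂ - ℓ * p * c * φ₃ + c₃ * φs)
      + ℓ ^ 2 * ρ5 * (c * cs - φ * (φ * c - 3 * c₃) - ℓ * p * c₃ * cs)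
      + ℓ * c₃s * ρ6 * (φ - ℓ * p * c + (ℓ * p) ^ 2 * c₃))) ≤ (p : ℚ) ^ (-(4 : ℤ)) :=
    (padicNorm_p_pow_mul_le 4 hD).trans (by rw [mul_one]; norm_num)
  refine (padicNorm.nonarchimedean (p := p)).trans (max_le h0 (padicNorm_mul_le_right hgx1 ?_))
  exact (padicNorm.nonarchimedean (p := p)).trans (max_le ((padicNorm.sub (p := p)).trans
    (max_le ((padicNorm.nonarchimedean (p := p)).trans (max_le h1 h2)) h3)) h4)

/-- **Fourth-order transport.**  For a class point `s` of the class with base `x < p` (`p ≥ 5`) and `p`-integral `ρ₃, ρ₄, ρ₅, ρ₆`: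
`‖ĝ_s(ρ₃ − pφ_sρ₄ + p²c_sρ₅ − p³c₃,sρ₆) − ĝ_x(ρ₃ − pφ_x(ℓρ₃ + ρ₄) + p²c_x(ℓ²ρ₃ + 2ℓρ₄ + ρ₅) − p³c₃,x(ℓ³ρ₃ + 3ℓ²ρ₄ + 3ℓρ₅ + ρ₆))‖`
`≤ p⁻⁴` (`ℓ = ⌊s/p⌋`, `c₃ = (φ³ − 3φφ₂ + 2φ₃)/6`, `φ₃ = phi3Expl`). -/
theorem fourthOrder_transport_bound (b : ℕ → ℤ) (hb : InPolytope b) (hp5 : 5 ≤ p) {x s : ℕ} (hx : x < p)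
    (hs : s ∈ classSet b p x) {ρ3 ρ4 ρ5 ρ6 : ℚ} (hρ3n : padicNorm p ρ3 ≤ 1) (hρ4n : padicNorm p ρ4 ≤ 1)
    (hρ5n : padicNorm p ρ5 ≤ 1) (hρ6n : padicNorm p ρ6 ≤ 1) :
    padicNorm p (gHat b p s * (ρ3 - (p : ℚ) * phiHat b p s * ρ4 + (p : ℚ) ^ 2 * curvHat b p s * ρ5
        - (p : ℚ) ^ 3 * ((phiHat b p s ^ 3 - 3 * phiHat b p s * phi2Hat b p s + 2 * phi3Expl b p s) / 6) * ρ6)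
      - gHat b p x * (ρ3 - (p : ℚ) * phiHat b p x * (((s / p : ℕ) : ℚ) * ρ3 + ρ4)
          + (p : ℚ) ^ 2 * curvHat b p x * (((s / p : ℕ) : ℚ) ^ 2 * ρ3 + 2 * ((s / p : ℕ) : ℚ) * ρ4 + ρ5)
          - (p : ℚ) ^ 3 * ((phiHat b p x ^ 3 - 3 * phiHat b p x * phi2Hat b p x + 2 * phi3Expl b p x) / 6)
              * (((s / p : ℕ) : ℚ) ^ 3 * ρ3 + 3 * ((s / p : ℕ) : ℚ) ^ 2 * ρ4 + 3 * ((s / p : ℕ) : ℚ) * ρ5 + ρ6))) ≤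
      (p : ℚ) ^ (-(4 : ℤ)) := by
  have hp2 : p ≠ 2 := by omega
  have hxmem : x ∈ classSet b p x := by
    refine mem_filter.2 ⟨mem_range.2 ?_, rfl⟩
    have := ((mem_classSet_iff b x s).1 hs).1
    have hsx : x ≤ s := by
      have h2 := (mem_filter.1 hs).2
      rw [Nat.mod_eq_of_lt hx] at h2; rw [← h2]; exact Nat.mod_le s p
    omega
  have hℓn : padicNorm p ((s / p : ℕ) : ℚ) ≤ 1 := by simpa using padicNorm.of_nat (p := p) (s / p)
  have hφ2c : phi2Hat b p x = phiHat b p x ^ 2 - 2 * curvHat b p x := by rw [curvHat]; ring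
  have hφ3c : phi3Expl b p x = 3 * ((phiHat b p x ^ 3 - 3 * phiHat b p x * phi2Hat b p x + 2 * phi3Expl b p x) / 6)
      + phiHat b p x ^ 3 - 3 * phiHat b p x * curvHat b p x := by rw [curvHat]; ring
  have hCc : padicNorm p (curvHat b p s - (curvHat b p x + ((s / p : ℕ) : ℚ) * p * (phiHat b p x * curvHat b p x
      - 3 * ((phiHat b p x ^ 3 - 3 * phiHat b p x * phi2Hat b p x + 2 * phi3Expl b p x) / 6)))) ≤ (p : ℚ) ^ (-(2 : ℤ)) := by
    have e : phiHat b p x * curvHat b p x - 3 * ((phiHat b p x ^ 3 - 3 * phiHat b p x * phi2Hat b p x + 2 * phi3Expl b p x) / 6)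
        = phiHat b p x * phi2Hat b p x - phi3Expl b p x := by rw [curvHat]; ring
    rw [e]; exact padicNorm_curvHat_sub_second_le b hp2 hx hs
  exact fourthOrder_transport_core hℓn (padicNorm_gHat_class b hb hp5 hx hxmem hxmem).1 (padicNorm_phiHat_le_one b hp2 x)
    (padicNorm_phiHat_le_one b hp2 s) (padicNorm_phi2Hat_le_one b hp2 x) (padicNorm_phi3Expl_le_one b hp2 x)
    (padicNorm_curvHat_le_one b hp2 x) (padicNorm_curvHat_le_one b hp2 s) (padicNorm_cubicExpl_le_one b hp5 x)
    (padicNorm_cubicExpl_le_one b hp5 s) hρ3n hρ4n hρ5n hρ6n hφ2c hφ3c (padicNorm_gHat_sub_fourth_le b hp5 hx hs)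
    (padicNorm_phiHat_sub_third_le b hp2 hx hs) hCc (padicNorm_cubicExpl_sub_le b hp5 hx hs)

end Summit.KontsevichZagierPeriods.Zeta5Search.SecondOrder

end
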